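import Literature.AnabelianGeometry.AbsoluteAnabelian.AbsTopIDef21GFGQuotientExistence
import HarnessLib

/-!
# [AbsTopI] Def 2.1 (i): the almost pro-`Σ`-maximal quotient is UNIQUE and FUNCTORIAL

S. Mochizuki, *Topics in Absolute Anabelian Geometry I: Generalities* (2012) [AbsTopI] (lit key
`paper:url-11ac98ba15fc`), Def 2.1 (i) p. 17 ("`π₁(X_k̄) ↠ Δ_X` an almost pro-`Σ`-maximal quotient … [Thus, given a
profinite group of GFG-type, there are, in general, many possible choices of construction data]") and the relative
statements of §2 (Prop 2.5 / Cor 2.8: homomorphisms `Π₁ → Π₂` of such extensions, `φ(Δ₁) ⊆ Δ₂`).  PROOF-ONLY sequel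
(no definition, no named fact) of `AbsTopIDef21GFGQuotientExistence.lean` (p441593, existence of the quotient
`P ⧸ K_Σ(U)`): with the GFG data of `AbsTopIProp23iGFGSurfaceModel.lean` (`π : P ↠ D` continuous, `ker π ≤ U`,
`IsMaxProSigmaQuotient Σ (π|_U : U ↠ π(U))`, `U ⊴ P` open) —

* `ker_subgroupMap_eq_of_gfg` / `ker_eq_of_gfg` — UNIQUENESS of the kernel: two GFG presentations `π₁ : P ↠ D₁`,
  `π₂ : P ↠ D₂` for the same `(P, U, Σ)` have the same kernel (`= K_Σ(U) ⊆ U ⊆ P`, `IsMaxProSigmaQuotient.ker_eq_iInf`);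
  hence `nonempty_continuousMulEquiv_of_gfg` — `D₁ ≃ₜ* D₂` compatibly with `π₁`, `π₂` (the quotient is unique up to
  unique topological isomorphism);
* `ker_le_ker_comp_of_gfg` — FUNCTORIALITY: for a continuous homomorphism `φ : P₁ → P₂` with `φ(U₁) ⊆ U₂` and GFG
  presentations `πᵢ` of `(Pᵢ, Uᵢ, Σ)`, `ker π₁ ≤ ker (π₂ ∘ φ)` (maximality of `K_Σ(U₁)` against the profinite pro-`Σ`
  group `π₂(U₂)`, `ker_le_ker_of_isMaxProSigmaQuotient`); hence `exists_continuous_hom_of_gfg` — a (unique) CONTINUOUS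
  `ψ : D₁ → D₂` with `ψ ∘ π₁ = π₂ ∘ φ`;
* `ker_anti_of_gfg` — MONOTONICITY in `Σ`: for `Σ₁ ⊆ Σ₂` and presentations on the same `(P, U)`, `ker π_{Σ₂} ≤ ker π_{Σ₁}`
  (the almost pro-`Σ₁` quotient is a quotient of the almost pro-`Σ₂` one).

Plain profinite group theory; OUR kernel check; nothing here bears on [IUTchIII] Cor. 3.12.
-/

noncomputable section

open Topology

universe u

namespace Literature.AnabelianGeometry.AbsoluteAnabelian

namespace GFGSurfaceModel

open Literature.AnabelianGeometry.Anabelioids (IsSigmaInteger)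
open Literature.AnabelianGeometry.SemiGraphs (IsProSigma)
open Literature.AnabelianGeometry.SemiGraphs.PSCDatum (IsMaxProSigmaQuotient)
open Literature.AnabelianGeometry.SemiGraphs.SemiGraphOfAnabelioids
open Literature.AnabelianGeometry.SemiGraphs.SemiGraphOfAnabelioids.IsProSigmaCompletion
open Literature.GroupTheory.ProfiniteSubquotients

variable {Sigma : Set ℕ} {P : Type u} [Group P] [TopologicalSpace P] [CompactSpace P]
  {D₁ : Type u} [Group D₁] [TopologicalSpace D₁] [IsTopologicalGroup D₁] [CompactSpace D₁] [T2Space D₁]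
  {D₂ : Type u} [Group D₂] [TopologicalSpace D₂] [IsTopologicalGroup D₂] [CompactSpace D₂] [T2Space D₂]
  {U : Subgroup P} {π₁ : P →* D₁} {π₂ : P →* D₂}

/-! ### Uniqueness of the kernel -/

omit [TopologicalSpace P] [CompactSpace P] [TopologicalSpace D₁] [IsTopologicalGroup D₁] [CompactSpace D₁]
  [T2Space D₁] in
/-- For `u ∈ U`: `π₁ u = 1 ↔ (π₁|_U) u = 1`. [cite: MochizukiAbsTopI2012, Def 2.1 (i) p.17] -/
private theorem subgroupMap_eq_one_iff (u : U) : (π₁.subgroupMap U) u = 1 ↔ π₁ (u : P) = 1 := by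
  constructor
  · intro h
    simpa using congrArg Subtype.val h
  · intro h
    exact Subtype.ext (by simpa using h)

/-- **The kernel of a GFG presentation restricted to `U` is DETERMINED**: two presentations `π₁|_U`, `π₂|_U` of the
maximal pro-`Σ` quotient of `U` have the same kernel (`= K_Σ(U)`, the intersection of the open normal `Σ`-index
subgroups of `U`). [cite: MochizukiAbsTopI2012, Def 2.1 (i) p.17] -/
theorem ker_subgroupMap_eq_of_gfg [TotallyDisconnectedSpace D₁] [TotallyDisconnectedSpace D₂]
    (hUc : IsClosed (U : Set P)) (hπ₁c : Continuous π₁) (hπ₂c : Continuous π₂)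
    (hmax₁ : IsMaxProSigmaQuotient Sigma (π₁.subgroupMap U)) (hmax₂ : IsMaxProSigmaQuotient Sigma (π₂.subgroupMap U)) :
    (π₁.subgroupMap U).ker = (π₂.subgroupMap U).ker := by
  haveI : CompactSpace U := compactSpace_of_isClosed hUc
  haveI : CompactSpace (U.map π₁) := compactSpace_of_isClosed (by
    have : ((U.map π₁ : Subgroup D₁) : Set D₁) = π₁ '' (U : Set P) := Subgroup.coe_map π₁ U
    rw [this]; exact (hUc.isCompact.image hπ₁c).isClosed)
  haveI : CompactSpace (U.map π₂) := compactSpace_of_isClosed (by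
    have : ((U.map π₂ : Subgroup D₂) : Set D₂) = π₂ '' (U : Set P) := Subgroup.coe_map π₂ U
    rw [this]; exact (hUc.isCompact.image hπ₂c).isClosed)
  rw [hmax₁.ker_eq_iInf, hmax₂.ker_eq_iInf]

/-- **UNIQUENESS of the almost pro-`Σ`-maximal quotient's kernel**: two GFG presentations `π₁ : P ↠ D₁`,
`π₂ : P ↠ D₂` of the SAME construction data `(P, U, Σ)` (`ker πᵢ ≤ U`, `πᵢ|_U` presenting the maximal pro-`Σ`
quotient of `U`) have the same kernel in `P`. [cite: MochizukiAbsTopI2012, Def 2.1 (i) p.17] -/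
theorem ker_eq_of_gfg [TotallyDisconnectedSpace D₁] [TotallyDisconnectedSpace D₂] (hUc : IsClosed (U : Set P))
    (hπ₁c : Continuous π₁) (hπ₂c : Continuous π₂)
    (hker₁ : π₁.ker ≤ U) (hker₂ : π₂.ker ≤ U)
    (hmax₁ : IsMaxProSigmaQuotient Sigma (π₁.subgroupMap U)) (hmax₂ : IsMaxProSigmaQuotient Sigma (π₂.subgroupMap U)) :
    π₁.ker = π₂.ker := by
  have hK := ker_subgroupMap_eq_of_gfg hUc hπ₁c hπ₂c hmax₁ hmax₂
  ext k
  rw [MonoidHom.mem_ker, MonoidHom.mem_ker]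
  constructor
  · intro hk
    have hkU : k ∈ U := hker₁ (by rw [MonoidHom.mem_ker]; exact hk)
    have h1 : (⟨k, hkU⟩ : U) ∈ (π₁.subgroupMap U).ker := by
      rw [MonoidHom.mem_ker, subgroupMap_eq_one_iff]; exact hk
    rw [hK, MonoidHom.mem_ker, subgroupMap_eq_one_iff] at h1
    exact h1
  · intro hk
    have hkU : k ∈ U := hker₂ (by rw [MonoidHom.mem_ker]; exact hk)
    have h2 : (⟨k, hkU⟩ : U) ∈ (π₂.subgroupMap U).ker := by
      rw [MonoidHom.mem_ker, subgroupMap_eq_one_iff]; exact hk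
    rw [← hK, MonoidHom.mem_ker, subgroupMap_eq_one_iff] at h2
    exact h2

/-- **UNIQUENESS up to unique topological isomorphism**: two GFG presentations of the same `(P, U, Σ)` have
topologically isomorphic targets, compatibly with the projections (`Δ_X` is well defined by the construction data).
[cite: MochizukiAbsTopI2012, Def 2.1 (i) p.17] -/
theorem nonempty_continuousMulEquiv_of_gfg [TotallyDisconnectedSpace D₁] [TotallyDisconnectedSpace D₂]
    (hUc : IsClosed (U : Set P))
    (hπ₁c : Continuous π₁) (hπ₁s : Function.Surjective π₁) (hπ₂c : Continuous π₂) (hπ₂s : Function.Surjective π₂)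
    (hker₁ : π₁.ker ≤ U) (hker₂ : π₂.ker ≤ U)
    (hmax₁ : IsMaxProSigmaQuotient Sigma (π₁.subgroupMap U)) (hmax₂ : IsMaxProSigmaQuotient Sigma (π₂.subgroupMap U)) :
    ∃ e : D₁ ≃ₜ* D₂, ∀ p : P, e (π₁ p) = π₂ p := by
  have hK := ker_eq_of_gfg hUc hπ₁c hπ₂c hker₁ hker₂ hmax₁ hmax₂
  haveI : π₁.ker.Normal := inferInstance
  obtain ⟨e₁, he₁⟩ := nonempty_continuousMulEquiv_quotient_of_surjective π₁ hπ₁c hπ₁s π₁.ker rfl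
  obtain ⟨e₂, he₂⟩ := nonempty_continuousMulEquiv_quotient_of_surjective π₂ hπ₂c hπ₂s π₁.ker hK.symm
  refine ⟨e₁.symm.trans e₂, fun p => ?_⟩
  have h1 : e₁.symm (π₁ p) = QuotientGroup.mk p := by
    rw [← he₁ p, ContinuousMulEquiv.symm_apply_apply]
  simp only [ContinuousMulEquiv.trans_apply, h1, he₂]

/-! ### Functoriality in the construction data -/

variable {P₂ : Type u} [Group P₂] [TopologicalSpace P₂] [CompactSpace P₂] {U₂ : Subgroup P₂} {ρ₂ : P₂ →* D₂}

omit [CompactSpace P] [IsTopologicalGroup D₁] [CompactSpace D₁] [T2Space D₁] in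
/-- **FUNCTORIALITY of the almost pro-`Σ`-maximal quotient** (the group-theoretic core of the relative statements
of [AbsTopI] §2): let `φ : P → P₂` be a continuous homomorphism with `φ(U) ⊆ U₂`, and `π₁ : P ↠ D₁`, `ρ₂ : P₂ ↠ D₂`
GFG presentations of `(P, U, Σ)`, `(P₂, U₂, Σ)`.  Then `ker π₁ ≤ ker (ρ₂ ∘ φ)`: `φ` descends to the quotients.
Proof: `ker π₁ = K_Σ(U)` dies in every continuous homomorphism from `U` to a profinite pro-`Σ` group
(`ker_le_ker_of_isMaxProSigmaQuotient`), in particular in `U → ρ₂(U₂)`, `u ↦ ρ₂(φ u)`.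
[cite: MochizukiAbsTopI2012, Prop 2.5 p.20] -/
theorem ker_le_ker_comp_of_gfg [TotallyDisconnectedSpace D₂] (φ : P →* P₂) (hφ : Continuous φ)
    (hφU : U ≤ U₂.comap φ)
    (hU₂c : IsClosed (U₂ : Set P₂)) (hρ₂c : Continuous ρ₂) (hker₁ : π₁.ker ≤ U)
    (hmax₁ : IsMaxProSigmaQuotient Sigma (π₁.subgroupMap U))
    (hmax₂ : IsMaxProSigmaQuotient Sigma (ρ₂.subgroupMap U₂)) :
    π₁.ker ≤ (ρ₂.comp φ).ker := by
  haveI : CompactSpace (U₂.map ρ₂) := compactSpace_of_isClosed (by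
    have : ((U₂.map ρ₂ : Subgroup D₂) : Set D₂) = ρ₂ '' (U₂ : Set P₂) := Subgroup.coe_map ρ₂ U₂
    rw [this]; exact (hU₂c.isCompact.image hρ₂c).isClosed)
  -- the continuous homomorphism `U → ρ₂(U₂)`, `u ↦ ρ₂ (φ u)`
  let θ : U →* (U₂.map ρ₂) :=
    (ρ₂.subgroupMap U₂).comp ((φ.comp U.subtype).codRestrict U₂ fun u => hφU u.2)
  have hθc : Continuous θ := by
    refine Continuous.subtype_mk ?_ _
    exact hρ₂c.comp (hφ.comp continuous_subtype_val)
  have hθ : ∀ u : U, ((θ u : U₂.map ρ₂) : D₂) = ρ₂ (φ u) := fun u => rfl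
  have hle := ker_le_ker_of_isMaxProSigmaQuotient hmax₁ hmax₂.proSigma θ hθc
  intro k hk
  have hkU : k ∈ U := hker₁ hk
  have h1 : (⟨k, hkU⟩ : U) ∈ (π₁.subgroupMap U).ker := by
    rw [MonoidHom.mem_ker, subgroupMap_eq_one_iff]; exact MonoidHom.mem_ker.mp hk
  have h2 := hle h1
  rw [MonoidHom.mem_ker] at h2 ⊢
  have := congrArg Subtype.val h2
  rw [hθ] at this
  simpa using this

omit [IsTopologicalGroup D₁] [CompactSpace D₁] in
/-- **The induced continuous homomorphism of almost pro-`Σ`-maximal quotients**: under the hypotheses of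
`ker_le_ker_comp_of_gfg`, with `π₁` surjective, there is a CONTINUOUS homomorphism `ψ : D₁ → D₂` with
`ψ ∘ π₁ = ρ₂ ∘ φ`, and it is unique. [cite: MochizukiAbsTopI2012, Prop 2.5 p.20] -/
theorem exists_continuous_hom_of_gfg [TotallyDisconnectedSpace D₂] (φ : P →* P₂) (hφ : Continuous φ)
    (hφU : U ≤ U₂.comap φ)
    (hU₂c : IsClosed (U₂ : Set P₂)) (hρ₂c : Continuous ρ₂) (hπ₁c : Continuous π₁)
    (hπ₁s : Function.Surjective π₁) (hker₁ : π₁.ker ≤ U)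
    (hmax₁ : IsMaxProSigmaQuotient Sigma (π₁.subgroupMap U))
    (hmax₂ : IsMaxProSigmaQuotient Sigma (ρ₂.subgroupMap U₂)) :
    ∃ ψ : D₁ →* D₂, Continuous ψ ∧ ψ.comp π₁ = ρ₂.comp φ ∧
      ∀ ψ' : D₁ →* D₂, ψ'.comp π₁ = ρ₂.comp φ → ψ' = ψ := by
  have hle := ker_le_ker_comp_of_gfg φ hφ hφU hU₂c hρ₂c hker₁ hmax₁ hmax₂
  let ψ : D₁ →* D₂ := π₁.liftOfSurjective hπ₁s ⟨ρ₂.comp φ, hle⟩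
  have hcomp : ψ.comp π₁ = ρ₂.comp φ := π₁.liftOfRightInverse_comp _ _ ⟨ρ₂.comp φ, hle⟩
  refine ⟨ψ, ?_, hcomp, fun ψ' hψ' => π₁.eq_liftOfRightInverse _ _ (ρ₂.comp φ) hle ψ' hψ'⟩
  -- continuity: `π₁` is a quotient map (continuous surjection, compact → Hausdorff)
  have hq : IsQuotientMap π₁ := (hπ₁c.isClosedMap).isQuotientMap hπ₁c hπ₁s
  rw [hq.continuous_iff]
  have : (ψ : D₁ → D₂) ∘ π₁ = ρ₂.comp φ := by
    ext p; exact congrArg (fun f : P →* D₂ => f p) hcomp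
  rw [this]
  exact hρ₂c.comp hφ

/-! ### Monotonicity in `Σ` -/

omit [IsTopologicalGroup D₂] [CompactSpace D₂] [T2Space D₂] in
/-- **Monotonicity in the prime set**: for `Σ₁ ⊆ Σ₂` and GFG presentations `π₁` (for `Σ₁`) and `π₂` (for `Σ₂`) of the
same `(P, U)`, `ker π₂ ≤ ker π₁` — the almost pro-`Σ₁`-maximal quotient is a quotient of the almost pro-`Σ₂`-maximal one
(every open normal `Σ₁`-index subgroup of `U` has `Σ₂`-index). [cite: MochizukiAbsTopI2012, Def 2.1 (i) p.17] -/
theorem ker_anti_of_gfg [TotallyDisconnectedSpace D₁] {Sigma₁ Sigma₂ : Set ℕ} (hS : Sigma₁ ⊆ Sigma₂)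
    (hUc : IsClosed (U : Set P))
    (hπ₁c : Continuous π₁) (hker₂ : π₂.ker ≤ U)
    (hmax₁ : IsMaxProSigmaQuotient Sigma₁ (π₁.subgroupMap U)) (hmax₂ : IsMaxProSigmaQuotient Sigma₂ (π₂.subgroupMap U)) :
    π₂.ker ≤ π₁.ker := by
  haveI : CompactSpace U := compactSpace_of_isClosed hUc
  haveI : CompactSpace (U.map π₁) := compactSpace_of_isClosed (by
    have : ((U.map π₁ : Subgroup D₁) : Set D₁) = π₁ '' (U : Set P) := Subgroup.coe_map π₁ U
    rw [this]; exact (hUc.isCompact.image hπ₁c).isClosed)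
  intro k hk
  have hkU : k ∈ U := hker₂ hk
  have h2 : (⟨k, hkU⟩ : U) ∈ (π₂.subgroupMap U).ker := by
    rw [MonoidHom.mem_ker, subgroupMap_eq_one_iff]; exact MonoidHom.mem_ker.mp hk
  -- `ker (π₂|_U) ≤ every open normal Σ₁-index subgroup` since `Σ₁ ⊆ Σ₂`, hence `≤ ker (π₁|_U) = K_{Σ₁}(U)`
  have h1 : (⟨k, hkU⟩ : U) ∈ (π₁.subgroupMap U).ker := by
    rw [hmax₁.ker_eq_iInf]
    refine Subgroup.mem_iInf.mpr fun N => ?_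
    obtain ⟨hNn, hNo, hNS⟩ := N.2
    have hNS₂ : IsSigmaInteger Sigma₂ N.1.index := ⟨hNS.1, fun p hp hpd => hS (hNS.2 p hp hpd)⟩
    exact hmax₂.ker_le N.1 hNn hNo hNS₂ h2
  rw [MonoidHom.mem_ker, subgroupMap_eq_one_iff] at h1
  exact h1

end GFGSurfaceModel

end Literature.AnabelianGeometry.AbsoluteAnabelian

end
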